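import Mathlib
import Summits.Ventures.PercRepro2.Defs
import Summits.Ventures.PercRepro2.Harris
import Summits.Ventures.PercRepro2.Graph
import Summits.Ventures.PercRepro2.Induced
import Summits.Ventures.PercRepro2.VdBKahn
import Summits.Ventures.PercRepro2.NestIID
import Summits.Ventures.PercRepro2.IIDRows
import Summits.Ventures.PercRepro2.ZMeanBound

/-!
# (ΔMONO) gives (DI) on every down-set with at most three maximal elements
(blind cell PercRepro2, mine-1 g10; MINE-1.md §26, the lead's layer-cake question)

For a principal down-set `↓H` the down-set sum of the per-union-hull terms is twice the BHK slack of
the avoided set `Hᶜ` (`sum_unionTerm_powerset`): both copies avoid `Hᶜ`, and the two-copy kernel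
expands into the four one-copy products. A down-set with maximal elements `H₁, …, H_k` is the union
of the principal ones, so its sum is the inclusion–exclusion alternating sum of slacks of unions
of avoided sets. With `Δ` antitone in the avoided set ((ΔMONO), `DeltaMonoRow`) and `Δ ≥ 0` (BHK):

* two generators: `Δ(T₁ ∪ T₂) ≤ Δ(T₁) + Δ(T₂)` (`bhkSlack_union_le_of_deltaMono`, landed);
* three generators (`bhkSlack_three_of_deltaMono`): pair every even set with an odd subset —
  `Δ(T₁∪T₂) ≤ Δ(T₁)`, `Δ(T₂∪T₃) ≤ Δ(T₂)`, `Δ(T₁∪T₃) ≤ Δ(T₃)`, `Δ(T₁∪T₂∪T₃) ≥ 0`;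
* hence `diRow_three_of_deltaMono`: the (DI) sum over `↓H₁ ∪ ↓H₂ ∪ ↓H₃` is nonnegative.

This matching argument stops at four generators (six pairs of generators, four singletons), and an
antitone nonnegative set function on four generators can have a negative alternating sum
(`F = 1` on sets of size ≤ 2, `0` above: `4 − 6 + 0 − 0`), so (ΔMONO) alone cannot give (DI) in
general; the census says (DI) holds anyway (MINE-1.md §25.12).
-/

namespace Summit.Ventures.PercRepro2

section DeltaMonoThree

variable {V : Type*} {E : Type*} [Fintype E] [DecidableEq E] [Fintype V] [DecidableEq V]
  {R : Type*} [CommRing R] [LinearOrder R] [IsStrictOrderedRing R]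

variable (p : E → R) (ends : E → Sym2 V) (s x y : V)

/-- The algebraic three-generator inequality from antitonicity and nonnegativity of the slack. -/
theorem bhkSlack_three_of_deltaMono (hp : IsProbVec p) (h : DeltaMonoRow p ends s x y)
    (T₁ T₂ T₃ : Finset V) :
    bhkSlack p ends s x y (T₁ ∪ T₂) + bhkSlack p ends s x y (T₁ ∪ T₃) +
        bhkSlack p ends s x y (T₂ ∪ T₃) ≤
      bhkSlack p ends s x y T₁ + bhkSlack p ends s x y T₂ + bhkSlack p ends s x y T₃ +
        bhkSlack p ends s x y (T₁ ∪ T₂ ∪ T₃) := by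
  have h12 : bhkSlack p ends s x y (T₁ ∪ T₂) ≤ bhkSlack p ends s x y T₁ :=
    bhkSlack_anti_of_deltaMono p ends s x y h Finset.subset_union_left
  have h23 : bhkSlack p ends s x y (T₂ ∪ T₃) ≤ bhkSlack p ends s x y T₂ :=
    bhkSlack_anti_of_deltaMono p ends s x y h Finset.subset_union_left
  have h13 : bhkSlack p ends s x y (T₁ ∪ T₃) ≤ bhkSlack p ends s x y T₃ :=
    bhkSlack_anti_of_deltaMono p ends s x y h Finset.subset_union_right
  have h123 := bhkSlack_nonneg p ends s x y hp (T₁ ∪ T₂ ∪ T₃)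
  linarith

omit [Fintype E] [DecidableEq E] [Fintype V] [LinearOrder R] [IsStrictOrderedRing R] in
/-- On `{C(s) = W}` the connection/avoidance events read off `W`. -/
lemma clusterEvent_inter_connAll_avoidAll (A T W : Finset V) :
    clusterEvent ends s (↑W : Set V) ∩ (connAll ends s A ∩ avoidAll ends s T) =
      if A ⊆ W ∧ Disjoint W T then clusterEvent ends s (↑W : Set V) else ∅ := by
  ext ω
  simp only [Set.mem_inter_iff, mem_clusterEvent, connAll, avoidAll, Set.mem_setOf_eq]
  constructor
  · rintro ⟨hW, hA, hT⟩
    have hcond : A ⊆ W ∧ Disjoint W T := by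
      refine ⟨fun a ha => ?_, Finset.disjoint_left.2 fun t htW htT => hT t htT ?_⟩
      · have : a ∈ cluster ends ω s := hA a ha
        rw [hW] at this; exact_mod_cast this
      · have : t ∈ cluster ends ω s := by rw [hW]; exact_mod_cast htW
        exact this
    rw [if_pos hcond]; exact hW
  · intro hω
    split_ifs at hω with hcond
    · refine ⟨hω, fun a ha => ?_, fun t ht hc => ?_⟩
      · show a ∈ cluster ends ω s
        rw [hω]; exact_mod_cast hcond.1 ha
      · have : t ∈ cluster ends ω s := hc
        rw [hω] at this
        exact Finset.disjoint_left.1 hcond.2 (by exact_mod_cast this) ht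
    · exact absurd hω (Set.notMem_empty ω)

omit [LinearOrder R] [IsStrictOrderedRing R] in
/-- The one-copy probability of `{A ⊆ C(s)} ∩ {C(s) ∩ T = ∅}` is the sum of the cluster law over
the admissible clusters. -/
lemma prob_connAll_avoidAll_eq_sum (A T : Finset V) :
    prob p (connAll ends s A ∩ avoidAll ends s T) =
      ∑ W : Finset V, if A ⊆ W ∧ Disjoint W T then clusterLaw p ends s W else 0 := by
  rw [prob_eq_sum_clusterEvent p ends s]
  refine Finset.sum_congr rfl fun W _ => ?_
  rw [clusterEvent_inter_connAll_avoidAll]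
  split_ifs
  · rfl
  · exact prob_empty p

omit [LinearOrder R] [IsStrictOrderedRing R] in
/-- The down-set sum of the per-union-hull terms as a double sum over the two clusters. -/
lemma sum_unionTerm_eq (𝒟 : Finset (Finset V)) :
    ∑ H' ∈ 𝒟, unionTerm p ends s x y H' =
      ∑ H₁ : Finset V, ∑ H₂ : Finset V, if H₁ ∪ H₂ ∈ 𝒟 then
        clusterLaw p ends s H₁ * clusterLaw p ends s H₂ *
          (((if x ∈ H₁ then 1 else 0) - (if x ∈ H₂ then 1 else 0)) *
            ((if y ∈ H₁ then 1 else 0) - (if y ∈ H₂ then 1 else 0))) else 0 := by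
  classical
  unfold unionTerm
  rw [Finset.sum_comm]
  refine Finset.sum_congr rfl fun H₁ _ => ?_
  rw [Finset.sum_comm]
  refine Finset.sum_congr rfl fun H₂ _ => ?_
  rw [Finset.sum_ite_eq 𝒟 (H₁ ∪ H₂)]

omit [LinearOrder R] [IsStrictOrderedRing R] in
/-- **Principal down-sets**: the (DI) sum over `↓H` is twice the BHK slack of `Hᶜ`. -/
theorem sum_unionTerm_powerset (H : Finset V) :
    ∑ H' ∈ H.powerset, unionTerm p ends s x y H' = 2 * bhkSlack p ends s x y Hᶜ := by
  classical
  rw [sum_unionTerm_eq]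
  -- the four one-copy masses over the clusters inside `H`
  set S : Finset V → R := fun A => ∑ W : Finset V,
    if A ⊆ W ∧ Disjoint W Hᶜ then clusterLaw p ends s W else 0 with hS
  have hxy : prob p (connAll ends s ({x} ∪ {y}) ∩ avoidAll ends s Hᶜ) = S ({x} ∪ {y}) :=
    prob_connAll_avoidAll_eq_sum p ends s _ _
  have hx : prob p (connAll ends s {x} ∩ avoidAll ends s Hᶜ) = S {x} :=
    prob_connAll_avoidAll_eq_sum p ends s _ _
  have hy : prob p (connAll ends s {y} ∩ avoidAll ends s Hᶜ) = S {y} :=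
    prob_connAll_avoidAll_eq_sum p ends s _ _
  have h0 : prob p (avoidAll ends s Hᶜ) = S ∅ := by
    have := prob_connAll_avoidAll_eq_sum p ends s ∅ Hᶜ
    have hc : connAll ends s (∅ : Finset V) = Set.univ := by
      ext ω; simp [connAll]
    rw [hc, Set.univ_inter] at this
    exact this
  unfold bhkSlack
  rw [hxy, hx, hy, h0]
  -- expand the double sum
  have key : ∀ H₁ H₂ : Finset V,
      (if H₁ ∪ H₂ ∈ H.powerset then clusterLaw p ends s H₁ * clusterLaw p ends s H₂ *
          (((if x ∈ H₁ then 1 else 0) - (if x ∈ H₂ then 1 else 0)) *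
            ((if y ∈ H₁ then 1 else 0) - (if y ∈ H₂ then 1 else 0))) else (0 : R)) =
        (if {x} ∪ {y} ⊆ H₁ ∧ Disjoint H₁ Hᶜ then clusterLaw p ends s H₁ else 0) *
            (if (∅ : Finset V) ⊆ H₂ ∧ Disjoint H₂ Hᶜ then clusterLaw p ends s H₂ else 0) -
          (if {x} ⊆ H₁ ∧ Disjoint H₁ Hᶜ then clusterLaw p ends s H₁ else 0) *
            (if {y} ⊆ H₂ ∧ Disjoint H₂ Hᶜ then clusterLaw p ends s H₂ else 0) -
          (if {y} ⊆ H₁ ∧ Disjoint H₁ Hᶜ then clusterLaw p ends s H₁ else 0) *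
            (if {x} ⊆ H₂ ∧ Disjoint H₂ Hᶜ then clusterLaw p ends s H₂ else 0) +
          (if (∅ : Finset V) ⊆ H₁ ∧ Disjoint H₁ Hᶜ then clusterLaw p ends s H₁ else 0) *
            (if {x} ∪ {y} ⊆ H₂ ∧ Disjoint H₂ Hᶜ then clusterLaw p ends s H₂ else 0) := by
    intro H₁ H₂
    have hd : ∀ W : Finset V, Disjoint W Hᶜ ↔ W ⊆ H := fun W => disjoint_compl_right_iff
    have hmem : H₁ ∪ H₂ ∈ H.powerset ↔ Disjoint H₁ Hᶜ ∧ Disjoint H₂ Hᶜ := by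
      rw [Finset.mem_powerset, Finset.union_subset_iff, hd H₁, hd H₂]
    have hxy1 : {x} ∪ {y} ⊆ H₁ ↔ x ∈ H₁ ∧ y ∈ H₁ := by
      rw [Finset.union_subset_iff, Finset.singleton_subset_iff, Finset.singleton_subset_iff]
    have hxy2 : {x} ∪ {y} ⊆ H₂ ↔ x ∈ H₂ ∧ y ∈ H₂ := by
      rw [Finset.union_subset_iff, Finset.singleton_subset_iff, Finset.singleton_subset_iff]
    simp only [hmem, hxy1, hxy2, Finset.singleton_subset_iff, Finset.empty_subset, true_and]
    by_cases h1 : Disjoint H₁ Hᶜ <;> by_cases h2 : Disjoint H₂ Hᶜ <;>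
      by_cases hx1 : x ∈ H₁ <;> by_cases hx2 : x ∈ H₂ <;> by_cases hy1 : y ∈ H₁ <;>
      by_cases hy2 : y ∈ H₂ <;> simp [h1, h2, hx1, hx2, hy1, hy2]
  simp_rw [key]
  simp only [Finset.sum_sub_distrib, Finset.sum_add_distrib, ← Finset.sum_mul_sum]
  simp only [hS]
  ring

omit [Fintype E] [DecidableEq E] [Fintype V] [LinearOrder R] [IsStrictOrderedRing R] in
/-- The power set of an intersection is the intersection of the power sets. -/
lemma powerset_inter_eq (s t : Finset V) : s.powerset ∩ t.powerset = (s ∩ t).powerset := by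
  ext u
  simp only [Finset.mem_inter, Finset.mem_powerset, Finset.subset_inter_iff]

omit [LinearOrder R] [IsStrictOrderedRing R] in
/-- Inclusion–exclusion for the union of three principal down-sets. -/
lemma sum_unionTerm_three (H₁ H₂ H₃ : Finset V) :
    ∑ H' ∈ H₁.powerset ∪ H₂.powerset ∪ H₃.powerset, unionTerm p ends s x y H' =
      2 * bhkSlack p ends s x y H₁ᶜ + 2 * bhkSlack p ends s x y H₂ᶜ +
        2 * bhkSlack p ends s x y H₃ᶜ -
        2 * bhkSlack p ends s x y (H₁ᶜ ∪ H₂ᶜ) - 2 * bhkSlack p ends s x y (H₁ᶜ ∪ H₃ᶜ) -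
        2 * bhkSlack p ends s x y (H₂ᶜ ∪ H₃ᶜ) +
        2 * bhkSlack p ends s x y (H₁ᶜ ∪ H₂ᶜ ∪ H₃ᶜ) := by
  classical
  set f := unionTerm p ends s x y with hf
  have e12 := Finset.sum_union_inter (s₁ := H₁.powerset) (s₂ := H₂.powerset) (f := f)
  have e3 := Finset.sum_union_inter (s₁ := H₁.powerset ∪ H₂.powerset) (s₂ := H₃.powerset)
    (f := f)
  have hdist : (H₁.powerset ∪ H₂.powerset) ∩ H₃.powerset =
      H₁.powerset ∩ H₃.powerset ∪ H₂.powerset ∩ H₃.powerset := Finset.union_inter_distrib_right _ _ _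
  have e13 := Finset.sum_union_inter (s₁ := H₁.powerset ∩ H₃.powerset)
    (s₂ := H₂.powerset ∩ H₃.powerset) (f := f)
  have hi : H₁.powerset ∩ H₃.powerset ∩ (H₂.powerset ∩ H₃.powerset) =
      (H₁ ∩ H₂ ∩ H₃).powerset := by
    rw [powerset_inter_eq, powerset_inter_eq, powerset_inter_eq]
    congr 1
    ext v; simp only [Finset.mem_inter]; tauto
  rw [hdist, powerset_inter_eq, powerset_inter_eq] at e3
  rw [hi] at e13
  rw [powerset_inter_eq] at e12
  rw [powerset_inter_eq, powerset_inter_eq] at e13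
  have p1 := sum_unionTerm_powerset p ends s x y H₁
  have p2 := sum_unionTerm_powerset p ends s x y H₂
  have p3 := sum_unionTerm_powerset p ends s x y H₃
  have p12 := sum_unionTerm_powerset p ends s x y (H₁ ∩ H₂)
  have p13 := sum_unionTerm_powerset p ends s x y (H₁ ∩ H₃)
  have p23 := sum_unionTerm_powerset p ends s x y (H₂ ∩ H₃)
  have p123 := sum_unionTerm_powerset p ends s x y (H₁ ∩ H₂ ∩ H₃)
  rw [Finset.compl_inter] at p12 p13 p23
  rw [Finset.compl_inter, Finset.compl_inter] at p123
  rw [← hf] at p1 p2 p3 p12 p13 p23 p123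
  linear_combination e3 + e12 - e13 + p1 + p2 + p3 - p12 - p13 - p23 + p123

/-- **(ΔMONO) ⟹ (DI) on every down-set with at most three maximal elements.** -/
theorem diRow_three_of_deltaMono (hp : IsProbVec p) (h : DeltaMonoRow p ends s x y)
    (H₁ H₂ H₃ : Finset V) :
    0 ≤ ∑ H' ∈ H₁.powerset ∪ H₂.powerset ∪ H₃.powerset, unionTerm p ends s x y H' := by
  rw [sum_unionTerm_three]
  have := bhkSlack_three_of_deltaMono p ends s x y hp h H₁ᶜ H₂ᶜ H₃ᶜ
  linarith

end DeltaMonoThree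

end Summit.Ventures.PercRepro2
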